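import Summits.CriticalPhenomena.SAWScalingLimit.Theses.SAWTensorRG
import Summits.CriticalPhenomena.SAWScalingLimit.Theorems.SAWTensorRGConformalAvoidanceDilation
import Literature.Probability.RandomPlanarGeometry.SAWScalingLimitFamily
import HarnessLib

/-!
# Quarter-turn invariance of critical-SAW avoidance limits (crux `ConformalAvoidance`, route
# `SAWTensorRG`, line `birth`, stub `stub_quarterTurnInvariantLimits`;
# item stmt-CriticalPhenomena-7605)

**What.** The registered stub `stub_quarterTurnInvariantLimits` of the skeleton of line `birth`:
approximation independence of the avoidance limits (two endpoint approximations of the same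
hull pair `(E, E')` give the same limit of `P_δ^E(range γ ⊆ closure E')` along `δ → 0+`) implies
quarter-turn invariance of the limit values: if `E = i D`, `E' = i D'` (carriers AND marked
points transported by the quarter turn `z ↦ i z`), `(a, b)` is an endpoint approximation of `D`
with avoidance limit `r₁` and `(c, d)` one of `E` with avoidance limit `r₂`, then `r₁ = r₂`.

**How.** The quarter turn is an EXACT automorphism `(x, y) ↦ (-y, x)` of every discretisation
`Ω_δ ⊆ δℤ²`; the tree fact `stub_quarterTurnCovariance : SAWBrickWallHomotopy.QuarterTurnCovariance`
(namespace `Summit.CriticalPhenomena.SAWScalingLimit.Cruxes.HexTransfer.PinTheShear`, file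
`SAWDevelopingMapHexTransferQuarterTurnCovariance.lean`) gives (1) the mesh-by-mesh identity of
laws: the critical SAW law of `Ω_δ` from `x` to `y`, pushed to curves and then pushed forward
along `z ↦ i z`, is the critical SAW law of `(iΩ)_δ` from the rotated sites
`(x₀, x₁) ↦ (-x₁, x₀)` pushed to curves; and (2) the rotated endpoint approximation
`δ ↦ ((-a δ 1, a δ 0), (-b δ 1, b δ 0))` of `D.map (z ↦ i z)`. Evaluating (1) on the closed
avoidance event `{range γ ⊆ closure (i S)}`, whose preimage under the push-forward along the
homeomorphism `z ↦ i z` is `{range γ ⊆ closure S}`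
(`preimage_curveClassMap_rangeSubset_closure_image`, from the landed dilation sibling
`SAWTensorRGConformalAvoidanceDilation.lean`), gives the mesh-by-mesh identity of avoidance
probabilities `Av(iΩ, iS; ã, b̃)(δ) = Av(Ω, S; a, b)(δ)` (`avoidance_quarterTurn`). The rotated
approximation is an endpoint approximation of `E` (`SAW.IsEndpointApprox.congr`, since `E` and
`D.map (z ↦ i z)` have the same carrier and marked points), its avoidance values tend to `r₁`,
and approximation independence at `(E, E')` between it and `(c, d)` gives `r₁ = r₂`.

Sources: V. Beffara, *Is critical 2D percolation universal?* (2008), §2.2 (the order-4 symmetry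
of the square lattice passes to every subsequential scaling limit); G. F. Lawler, O. Schramm,
W. Werner, *On the scaling limit of planar self-avoiding walk* (2004), §3.4.2 (lattice
symmetries of the limit). All [folklore].
-/

noncomputable section

open scoped Topology ENNReal NNReal
open Filter Set MeasureTheory
open Literature.Probability.RandomPlanarGeometry Literature.Probability.LatticeModels
open Summit.CriticalPhenomena.SAWScalingLimit.Cruxes.HexTransfer.PinTheShear
  (stub_quarterTurnCovariance)

namespace Summit.CriticalPhenomena.SAWScalingLimit.Theorems.ConformalAvoidance

/-- **Mesh-by-mesh quarter-turn identity for avoidance probabilities**: the probability that the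
critical SAW of `(iΩ)_δ` from the rotated site `(-x₁, x₀)` to the rotated site `(-y₁, y₀)` stays
in `closure (i S)` equals the probability that the critical SAW of `Ω_δ` from `x` to `y` stays in
`closure S` (the exact quarter-turn covariance `stub_quarterTurnCovariance.1` of the critical
`δℤ²` SAW law, evaluated on the closed avoidance event). [folklore] -/
theorem avoidance_quarterTurn (Ω S : Set ℂ) (δ : ℝ) (x y : Site 2) :
    ((SAW.law ((similarity Complex.I Complex.I_ne_zero 0) '' Ω) δ ![-(x 1), x 0] ![-(y 1), y 0]).map
        (fun γ => γ.curve))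
        (CurveClass.rangeSubset (closure ((similarity Complex.I Complex.I_ne_zero 0) '' S))) =
      ((SAW.law Ω δ x y).map (fun γ => γ.curve)) (CurveClass.rangeSubset (closure S)) := by
  rw [← stub_quarterTurnCovariance.1 Ω δ x y,
    Measure.map_apply (measurable_curveClassMap_similarity _ _ _)
      (CurveClass.measurableSet_rangeSubset isClosed_closure),
    preimage_curveClassMap_rangeSubset_closure_image]

/-- **STUB 2q of line `birth` (crux `ConformalAvoidance`, route `SAWTensorRG`): approximation
independence ⇒ quarter-turn invariance of the avoidance limits.** If two endpoint approximations
of the same hull pair always give the same avoidance limit, then for `E = i D`, `E' = i D'`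
(carriers and marked points transported by the quarter turn `z ↦ i z`), an endpoint approximation
`(a, b)` of `D` with avoidance limit `r₁` and an endpoint approximation `(c, d)` of `E` with
avoidance limit `r₂`, one has `r₁ = r₂`: the rotated approximation
`δ ↦ ((-a δ 1, a δ 0), (-b δ 1, b δ 0))` of `E` (`stub_quarterTurnCovariance.2`) has avoidance
values `Av(D, D'; a, b)(δ) → r₁` by the exact lattice symmetry `(x, y) ↦ (-y, x)` of `δℤ²`
(`avoidance_quarterTurn`), and approximation independence at `(E, E')` compares it with `(c, d)`.
[folklore] -/
theorem stub_quarterTurnInvariantLimits :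
    (∀ (D D' : DobrushinDomain) (a b c d : ℝ → Site 2),
      SAW.IsEndpointApprox D a b → SAW.IsEndpointApprox D c d →
      D'.carrier ⊆ D.carrier → D'.pt 0 = D.pt 0 → D'.pt 1 = D.pt 1 →
      (∃ ε : ℝ, 0 < ε ∧ D'.carrier ∩ Metric.ball (D.pt 0) ε = D.carrier ∩ Metric.ball (D.pt 0) ε ∧
        D'.carrier ∩ Metric.ball (D.pt 1) ε = D.carrier ∩ Metric.ball (D.pt 1) ε) →
      ∀ r₁ r₂ : ENNReal,
        Tendsto (fun δ => ((SAW.law D.carrier δ (a δ) (b δ)).map (fun γ => γ.curve))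
            (CurveClass.rangeSubset (closure D'.carrier))) (𝓝[>] 0) (𝓝 r₁) →
        Tendsto (fun δ => ((SAW.law D.carrier δ (c δ) (d δ)).map (fun γ => γ.curve))
            (CurveClass.rangeSubset (closure D'.carrier))) (𝓝[>] 0) (𝓝 r₂) → r₁ = r₂) →
    ∀ (D D' E E' : DobrushinDomain) (a b c d : ℝ → Site 2),
      SAW.IsEndpointApprox D a b → SAW.IsEndpointApprox E c d →
      D'.carrier ⊆ D.carrier → D'.pt 0 = D.pt 0 → D'.pt 1 = D.pt 1 →
      (∃ ε : ℝ, 0 < ε ∧ D'.carrier ∩ Metric.ball (D.pt 0) ε = D.carrier ∩ Metric.ball (D.pt 0) ε ∧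
        D'.carrier ∩ Metric.ball (D.pt 1) ε = D.carrier ∩ Metric.ball (D.pt 1) ε) →
      E'.carrier ⊆ E.carrier → E'.pt 0 = E.pt 0 → E'.pt 1 = E.pt 1 →
      (∃ ε : ℝ, 0 < ε ∧ E'.carrier ∩ Metric.ball (E.pt 0) ε = E.carrier ∩ Metric.ball (E.pt 0) ε ∧
        E'.carrier ∩ Metric.ball (E.pt 1) ε = E.carrier ∩ Metric.ball (E.pt 1) ε) →
      E.carrier = (similarity Complex.I Complex.I_ne_zero 0) '' D.carrier →
      E'.carrier = (similarity Complex.I Complex.I_ne_zero 0) '' D'.carrier →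
      E.pt 0 = (similarity Complex.I Complex.I_ne_zero 0) (D.pt 0) → E.pt 1 = (similarity Complex.I Complex.I_ne_zero 0) (D.pt 1) →
      ∀ r₁ r₂ : ENNReal,
        Tendsto (fun δ => ((SAW.law D.carrier δ (a δ) (b δ)).map (fun γ => γ.curve))
            (CurveClass.rangeSubset (closure D'.carrier))) (𝓝[>] 0) (𝓝 r₁) →
        Tendsto (fun δ => ((SAW.law E.carrier δ (c δ) (d δ)).map (fun γ => γ.curve))
            (CurveClass.rangeSubset (closure E'.carrier))) (𝓝[>] 0) (𝓝 r₂) → r₁ = r₂ := by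
  intro hAIL D D' E E' a b c d hab hcd _ _ _ _ hE'sub hE'0 hE'1 hE'ball hE hE' hE0 hE1 r₁ r₂ hr₁ hr₂
  -- (i) the rotated endpoint approximation `δ ↦ ((-a δ 1, a δ 0), (-b δ 1, b δ 0))` of `E = i D`
  have happ : SAW.IsEndpointApprox E (fun δ => ![-(a δ 1), a δ 0]) (fun δ => ![-(b δ 1), b δ 0]) :=
    (stub_quarterTurnCovariance.2 D a b hab).congr
      (by rw [MarkedDomain.carrier_map, hE]) (by rw [MarkedDomain.pt_map, hE0])
      (by rw [MarkedDomain.pt_map, hE1])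
  -- (ii) the avoidance values of the rotated approximation are `Av(D, D'; a, b)(δ) → r₁`
  have h₁ : Tendsto (fun δ => ((SAW.law E.carrier δ ![-(a δ 1), a δ 0] ![-(b δ 1), b δ 0]).map
      (fun γ => γ.curve)) (CurveClass.rangeSubset (closure E'.carrier))) (𝓝[>] 0) (𝓝 r₁) := by
    rw [hE, hE']
    exact hr₁.congr fun δ => (avoidance_quarterTurn D.carrier D'.carrier δ (a δ) (b δ)).symm
  -- (iii) approximation independence at `(E, E')`
  exact hAIL E E' _ _ c d happ hcd hE'sub hE'0 hE'1 hE'ball r₁ r₂ h₁ hr₂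

end Summit.CriticalPhenomena.SAWScalingLimit.Theorems.ConformalAvoidance

end
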